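import Mathlib
import Summits.NavierStokesRegularity.Statement
import Literature.Analysis.FluidPDE.ClassicalSolution
import Literature.Analysis.FluidPDE.LerayHopf
import Literature.Analysis.FluidPDE.SuitableWeak
import Literature.Analysis.FluidPDE.LocalTypeI
import Literature.Analysis.FluidPDE.CKN1982Setting
import Literature.Analysis.FluidPDE.ClassicalSuitable
import Literature.Analysis.FluidPDE.NSViscosityRescaling
import Literature.Analysis.FluidPDE.NSLerayHopfABCScaling
import Literature.Analysis.FluidPDE.PressureDecayEstimate
import Literature.Analysis.FluidPDE.PressureDecayEstimateProofs
import Literature.Analysis.FluidPDE.ClassicalTopPointCubic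
import Literature.Analysis.FluidPDE.BesovBlowupConcentration
import Literature.Analysis.FluidPDE.LerayHopfSpatialGradient
import Literature.Analysis.FluidPDE.NSSuitableESSProofs
import Literature.Analysis.FluidPDE.Seregin2020ScaledEnergyBounds
import Summits.NavierStokesRegularity.NavierStokesRegularity.Theses.RootDecompLitSlice
import Summits.NavierStokesRegularity.NavierStokesRegularity.Theses.RootDecompMorreyBudget
import Summits.NavierStokesRegularity.NavierStokesRegularity.Theses.EulerZoomLiouville
import Summits.NavierStokesRegularity.NavierStokesRegularity.Theses.RootDecompStaticSkirt
import Summits.NavierStokesRegularity.NavierStokesRegularity.Theorems.EulerZoomLiouvilleSereginZoomReduction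
import Summits.NavierStokesRegularity.NavierStokesRegularity.Theorems.QuarterJoltNoTerminalJoltPosition
import Summits.NavierStokesRegularity.NavierStokesRegularity.Theorems.RootDecompStaticSkirtEngineKillsConicalJolt
import Summits.NavierStokesRegularity.NavierStokesRegularity.Theorems.RootDecompStaticSkirtJoltingCells
import Summits.NavierStokesRegularity.NavierStokesRegularity.Theorems.RootDecompStaticSkirtOnsagerSeam

/-!
# N25 «THE STATIC SKIRT» · ONSAGER EDGE DISSIPATION LADDER — EE ⟹ NA ⟹ D0 and the PROVED budget rung CC ⟹ D0

Lens-6 g16 kernels K9a (EE ⟹ NA at the laminar rate `r^{a−1} = Re(r)⁻¹`), K9b (NA ⟹ D0) and K10 «THE BUDGET RUNG IS A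
THEOREM» (CC ⟹ D0: the local energy inequality at cylinders touching the blow-up time of the normalised classical solution,
suitable there by K7, pressure gauged by K6 — both from `Theorems/RootDecompStaticSkirtOnsagerSeam.lean`), critic row 163
booking (3).  Every Onsager-edge statement is written as the VERBATIM ledger signature of the child route
`RootDecompOnsagerEdge` items (CC `ConicalSkirtCubicGauge`, NA `ConicalSkirtNoAnomaly`, aside D0
`ConicalSkirtDissipationBudget`); EE `ConicalSkirtDissipationGauge` (not booked; EE ⟺ NA ∧ QL) is spelled inline.

Sources: CKN 1982 §2; Seregin 2020 local energy bound (tree `Seregin2020.localEnergyBound_top`); Duchon–Robert 2000;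
Drivas–Eyink 2019 (arXiv:1710.05205); lens file HOME/decomp-ns-lens-6/OnsagerEdge.lean §15–§16.
-/

noncomputable section

set_option linter.dupNamespace false

namespace Summit.NavierStokesRegularity.NavierStokesRegularity.Theorems.RootDecompStaticSkirtOnsagerLadder

open Summit.NavierStokesRegularity.NavierStokesRegularity.Theses
open Summit.NavierStokesRegularity.NavierStokesRegularity.Theorems.RootDecompStaticSkirtOnsagerSeam
  (pressureGauge_of_cubicGauge apex_suitable)
open scoped Topology ENNReal NNReal InnerProductSpace RealInnerProductSpace
open Filter Set MeasureTheory Metric Function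
open Literature.Analysis.FluidPDE

/-! ## K9 · the ladder EE ⟹ NA ⟹ D0 with its rates -/

/-- the gauge weight `r ↦ r^{γ}` (as `ℝ≥0∞`) tends to `0` from the right for `γ > 0`. -/
theorem tendsto_ofReal_rpow_nhdsGT_zero {γ : ℝ} (hγ : 0 < γ) :
    Tendsto (fun r : ℝ => ENNReal.ofReal (r ^ γ)) (𝓝[Set.Ioi 0] 0) (𝓝 0) := by
  have h : Tendsto (fun r : ℝ => r ^ γ) (𝓝[Set.Ioi 0] (0 : ℝ)) (𝓝 0) := by
    have hc : ContinuousAt (fun r : ℝ => r ^ γ) 0 := Real.continuousAt_rpow_const 0 γ (Or.inr hγ.le)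
    have := hc.tendsto
    rw [Real.zero_rpow hγ.ne'] at this
    exact this.mono_left nhdsWithin_le_nhds
  rw [← ENNReal.ofReal_zero]
  exact ENNReal.tendsto_ofReal h

/-- splitting of the budget weight: `r^{2(a−1)} = r^{a−1} · r^{a−1}` (as `ℝ≥0∞`, `r > 0`). -/
theorem ofReal_rpow_two_mul {r γ : ℝ} (hr : 0 < r) :
    ENNReal.ofReal (r ^ (2 * γ)) = ENNReal.ofReal (r ^ γ) * ENNReal.ofReal (r ^ γ) := by
  rw [show 2 * γ = γ + γ by ring, Real.rpow_add hr, ENNReal.ofReal_mul (Real.rpow_nonneg hr.le _)]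

/-- **K9a · EE ⟹ NA, with the laminar rate**: under the dissipation gauge, `𝔇(r) ≤ r^{a−1}·M → 0` — laminar cores have
no anomaly, and the convergence RATE is `Re(r)⁻¹ = r^{a−1}` (the census's «δ_d·Re = O(1)»). -/
theorem noAnomaly_of_dissipationGauge
    (hEE : ∀ (ν T : ℝ), 0 < ν → 0 < T → ∀ (u : ℝ → EuclideanSpace ℝ (Fin 3) → EuclideanSpace ℝ (Fin 3)) (p : ℝ → EuclideanSpace ℝ (Fin 3) → ℝ), Literature.Analysis.FluidPDE.IsMaximalSmoothSolution ν 0 u p T → Literature.Analysis.FluidPDE.IsLerayHopfOn T ν 0 (u 0) u → Literature.Analysis.FluidPDE.HasRapidSpatialDecay (u 0) → Filter.Tendsto (fun t => MeasureTheory.eLpNorm (u t - u T) 2 MeasureTheory.volume) (nhdsWithin T (Set.Iio T)) (nhds 0) → ∀ (x₀ : EuclideanSpace ℝ (Fin 3)) (r : ℕ → ℝ) (a r₀ C J c η : ℝ), ((∀ k, 0 < r k) ∧ Filter.Tendsto r Filter.atTop (nhds 0) ∧ Filter.Tendsto (fun k => (r k)⁻¹ * ∫ x in Metric.ball x₀ (r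 k), ‖u T x‖ ^ 2) Filter.atTop Filter.atTop) → (∃ c : ℝ, 0 < c ∧ ∀ k, ∃ t ∈ Set.Ioo (T - r k ^ 2) T, c * (∫ x in Metric.ball x₀ (r k), ‖u T x‖ ^ 2) < ∫ x in Metric.ball x₀ (r k), ‖u t x - u T x‖ ^ 2) → 1 < a → a ≤ 3 / 2 → 0 < r₀ → 0 ≤ C → 0 ≤ J → 0 < c → 0 < η → (∀ ρ ∈ Set.Ioc 0 r₀, (∫⁻ x in Metric.ball x₀ ρ, ‖u T x‖ₑ ^ 2 ≤ ENNReal.ofReal (C * ρ ^ (3 - 2 * a))) ∧ ∀ s ∈ Set.Ioo (T - ρ ^ 2 / ν) T, ∫⁻ x in Metric.ball x₀ ρ, ‖u s x - u T x‖ₑ ^ 2 ≤ ENNReal.ofReal J * ∫⁻ x in Metric.ball x₀ ρ, ‖u T x‖ₑ ^ 2) → (∀ k : ℕ, ENNReal.ofReal (c * r k ^ (3 - 2 * a)) ≤ ∫⁻ x in Metric.ball x₀ (r k), ‖u T x‖ₑ ^ 2 ∧ ∀ s ∈ Set.Ioo (T - r k ^ (1 + a) / ν) T, ENNReal.ofReal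 η * ∫⁻ x in Metric.ball x₀ (r k), ‖u T x‖ₑ ^ 2 ≤ ∫⁻ x in Metric.ball x₀ (r k), ‖u s x‖ₑ ^ 2) → ∃ (r₁ : ℝ) (M : NNReal), 0 < r₁ ∧ ∀ r' ∈ Set.Ioc 0 r₁, ENNReal.ofReal (r' ^ (a - 1)) * Literature.Analysis.FluidPDE.cknE r' (ν * T, x₀) (fun s y => fderiv ℝ (fun y => ν⁻¹ • u (s / ν) y) y) ≤ (M : ENNReal)) :
    ∀ (ν T : ℝ), 0 < ν → 0 < T → ∀ (u : ℝ → EuclideanSpace ℝ (Fin 3) → EuclideanSpace ℝ (Fin 3)) (p : ℝ → EuclideanSpace ℝ (Fin 3) → ℝ), Literature.Analysis.FluidPDE.IsMaximalSmoothSolution ν 0 u p T → Literature.Analysis.FluidPDE.IsLerayHopfOn T ν 0 (u 0) u → Literature.Analysis.FluidPDE.HasRapidSpatialDecay (u 0) → Filter.Tendsto (fun t => MeasureTheory.eLpNorm (u t - u T) 2 MeasureTheory.volume) (nhdsWithin T (Set.Iio T)) (nhds 0) → ∀ (x₀ : EuclideanSpace ℝ (Fin 3)) (r : ℕ → ℝ)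 (a r₀ C J c η : ℝ), ((∀ k, 0 < r k) ∧ Filter.Tendsto r Filter.atTop (nhds 0) ∧ Filter.Tendsto (fun k => (r k)⁻¹ * ∫ x in Metric.ball x₀ (r k), ‖u T x‖ ^ 2) Filter.atTop Filter.atTop) → (∃ c : ℝ, 0 < c ∧ ∀ k, ∃ t ∈ Set.Ioo (T - r k ^ 2) T, c * (∫ x in Metric.ball x₀ (r k), ‖u T x‖ ^ 2) < ∫ x in Metric.ball x₀ (r k), ‖u t x - u T x‖ ^ 2) → 1 < a → a ≤ 3 / 2 → 0 < r₀ → 0 ≤ C → 0 ≤ J → 0 < c → 0 < η → (∀ ρ ∈ Set.Ioc 0 r₀, (∫⁻ x in Metric.ball x₀ ρ, ‖u T x‖ₑ ^ 2 ≤ ENNReal.ofReal (C * ρ ^ (3 - 2 * a))) ∧ ∀ s ∈ Set.Ioo (T - ρ ^ 2 / ν) T, ∫⁻ x in Metric.ball x₀ ρ, ‖u s x - u T x‖ₑ ^ 2 ≤ ENNReal.ofReal J * ∫⁻ x in Metric.ball x₀ ρ, ‖u T x‖ₑ ^ 2) → (∀ k : ℕ, ENNReal.ofReal (c * r k ^ (3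 - 2 * a)) ≤ ∫⁻ x in Metric.ball x₀ (r k), ‖u T x‖ₑ ^ 2 ∧ ∀ s ∈ Set.Ioo (T - r k ^ (1 + a) / ν) T, ENNReal.ofReal η * ∫⁻ x in Metric.ball x₀ (r k), ‖u T x‖ₑ ^ 2 ≤ ∫⁻ x in Metric.ball x₀ (r k), ‖u s x‖ₑ ^ 2) → Filter.Tendsto (fun r' : ℝ => ENNReal.ofReal (r' ^ (2 * (a - 1))) * Literature.Analysis.FluidPDE.cknE r' (ν * T, x₀) (fun s y => fderiv ℝ (fun y => ν⁻¹ • u (s / ν) y) y)) (nhdsWithin 0 (Set.Ioi 0)) (nhds 0) := by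
  intro ν T hν hT u p hmax hLH hdec htend x₀ r a r₀ C J c η hs hj ha1 ha2 hr₀ hC hJ hc hη htemp hfloor
  obtain ⟨r₁, M, hr₁, hg⟩ :=
    hEE ν T hν hT u p hmax hLH hdec htend x₀ r a r₀ C J c η hs hj ha1 ha2 hr₀ hC hJ hc hη htemp hfloor
  have hγ : 0 < a - 1 := by linarith
  have hup : Tendsto (fun r' : ℝ => ENNReal.ofReal (r' ^ (a - 1)) * (M : ℝ≥0∞)) (𝓝[Set.Ioi 0] (0 : ℝ)) (𝓝 0) := by
    have h := ENNReal.Tendsto.mul_const (b := (M : ℝ≥0∞)) (tendsto_ofReal_rpow_nhdsGT_zero hγ)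
      (Or.inr ENNReal.coe_ne_top)
    rwa [zero_mul] at h
  refine tendsto_of_tendsto_of_tendsto_of_le_of_le' tendsto_const_nhds hup
    (Eventually.of_forall fun _ => zero_le) ?_
  filter_upwards [Ioc_mem_nhdsGT hr₁] with r' hr'
  show ENNReal.ofReal (r' ^ (2 * (a - 1))) *
      cknE r' (ν * T, x₀) (fun s y => fderiv ℝ (fun y => ν⁻¹ • u (s / ν) y) y) ≤
    ENNReal.ofReal (r' ^ (a - 1)) * (M : ℝ≥0∞)
  rw [ofReal_rpow_two_mul hr'.1, mul_assoc]
  exact mul_le_mul' le_rfl (hg r' hr')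

/-- **K9b · NA ⟹ D0**: a vanishing gauged dissipation is eventually `≤ 1`. -/
theorem dissipationBudget_of_noAnomaly
    (hNA : ∀ (ν T : ℝ), 0 < ν → 0 < T → ∀ (u : ℝ → EuclideanSpace ℝ (Fin 3) → EuclideanSpace ℝ (Fin 3)) (p : ℝ → EuclideanSpace ℝ (Fin 3) → ℝ), Literature.Analysis.FluidPDE.IsMaximalSmoothSolution ν 0 u p T → Literature.Analysis.FluidPDE.IsLerayHopfOn T ν 0 (u 0) u → Literature.Analysis.FluidPDE.HasRapidSpatialDecay (u 0) → Filter.Tendsto (fun t => MeasureTheory.eLpNorm (u t - u T) 2 MeasureTheory.volume) (nhdsWithin T (Set.Iio T)) (nhds 0) → ∀ (x₀ : EuclideanSpace ℝ (Fin 3)) (r : ℕ → ℝ) (a r₀ C J c η : ℝ), ((∀ k, 0 < r k) ∧ Filter.Tendsto r Filter.atTop (nhds 0) ∧ Filter.Tendsto (fun k => (r k)⁻¹ * ∫ x in Metric.ball x₀ (r k), ‖u T x‖ ^ 2) Filter.atTop Filter.atTop) → (∃ c : ℝ, 0 < c ∧ ∀ k, ∃ t ∈ Set.Ioo (T - r k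 ^ 2) T, c * (∫ x in Metric.ball x₀ (r k), ‖u T x‖ ^ 2) < ∫ x in Metric.ball x₀ (r k), ‖u t x - u T x‖ ^ 2) → 1 < a → a ≤ 3 / 2 → 0 < r₀ → 0 ≤ C → 0 ≤ J → 0 < c → 0 < η → (∀ ρ ∈ Set.Ioc 0 r₀, (∫⁻ x in Metric.ball x₀ ρ, ‖u T x‖ₑ ^ 2 ≤ ENNReal.ofReal (C * ρ ^ (3 - 2 * a))) ∧ ∀ s ∈ Set.Ioo (T - ρ ^ 2 / ν) T, ∫⁻ x in Metric.ball x₀ ρ, ‖u s x - u T x‖ₑ ^ 2 ≤ ENNReal.ofReal J * ∫⁻ x in Metric.ball x₀ ρ, ‖u T x‖ₑ ^ 2) → (∀ k : ℕ, ENNReal.ofReal (c * r k ^ (3 - 2 * a)) ≤ ∫⁻ x in Metric.ball x₀ (r k), ‖u T x‖ₑ ^ 2 ∧ ∀ s ∈ Set.Ioo (T - r k ^ (1 + a) / ν) T, ENNReal.ofReal η * ∫⁻ x in Metric.ball x₀ (r k), ‖u T x‖ₑ ^ 2 ≤ ∫⁻ x in Metric.ball x₀ (r k), ‖u s x‖ₑ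 ^ 2) → Filter.Tendsto (fun r' : ℝ => ENNReal.ofReal (r' ^ (2 * (a - 1))) * Literature.Analysis.FluidPDE.cknE r' (ν * T, x₀) (fun s y => fderiv ℝ (fun y => ν⁻¹ • u (s / ν) y) y)) (nhdsWithin 0 (Set.Ioi 0)) (nhds 0)) :
    ∀ (ν T : ℝ), 0 < ν → 0 < T → ∀ (u : ℝ → EuclideanSpace ℝ (Fin 3) → EuclideanSpace ℝ (Fin 3)) (p : ℝ → EuclideanSpace ℝ (Fin 3) → ℝ), Literature.Analysis.FluidPDE.IsMaximalSmoothSolution ν 0 u p T → Literature.Analysis.FluidPDE.IsLerayHopfOn T ν 0 (u 0) u → Literature.Analysis.FluidPDE.HasRapidSpatialDecay (u 0) → Filter.Tendsto (fun t => MeasureTheory.eLpNorm (u t - u T) 2 MeasureTheory.volume) (nhdsWithin T (Set.Iio T)) (nhds 0) → ∀ (x₀ : EuclideanSpace ℝ (Fin 3)) (r : ℕ → ℝ) (a r₀ C J c η : ℝ), ((∀ k, 0 < r k) ∧ Filter.Tendsto r Filter.atTop (nhds 0) ∧ Filter.Tendsto (fun k => (r k)⁻¹ * ∫ x in Metric.ball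 x₀ (r k), ‖u T x‖ ^ 2) Filter.atTop Filter.atTop) → (∃ c : ℝ, 0 < c ∧ ∀ k, ∃ t ∈ Set.Ioo (T - r k ^ 2) T, c * (∫ x in Metric.ball x₀ (r k), ‖u T x‖ ^ 2) < ∫ x in Metric.ball x₀ (r k), ‖u t x - u T x‖ ^ 2) → 1 < a → a ≤ 3 / 2 → 0 < r₀ → 0 ≤ C → 0 ≤ J → 0 < c → 0 < η → (∀ ρ ∈ Set.Ioc 0 r₀, (∫⁻ x in Metric.ball x₀ ρ, ‖u T x‖ₑ ^ 2 ≤ ENNReal.ofReal (C * ρ ^ (3 - 2 * a))) ∧ ∀ s ∈ Set.Ioo (T - ρ ^ 2 / ν) T, ∫⁻ x in Metric.ball x₀ ρ, ‖u s x - u T x‖ₑ ^ 2 ≤ ENNReal.ofReal J * ∫⁻ x in Metric.ball x₀ ρ, ‖u T x‖ₑ ^ 2) → (∀ k : ℕ, ENNReal.ofReal (c * r k ^ (3 - 2 * a)) ≤ ∫⁻ x in Metric.ball x₀ (r k), ‖u T x‖ₑ ^ 2 ∧ ∀ s ∈ Set.Ioo (T - r k ^ (1 + a) / ν) T, ENNReal.ofReal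 η * ∫⁻ x in Metric.ball x₀ (r k), ‖u T x‖ₑ ^ 2 ≤ ∫⁻ x in Metric.ball x₀ (r k), ‖u s x‖ₑ ^ 2) → ∃ (r₁ : ℝ) (M : NNReal), 0 < r₁ ∧ ∀ r' ∈ Set.Ioc 0 r₁, ENNReal.ofReal (r' ^ (2 * (a - 1))) * Literature.Analysis.FluidPDE.cknE r' (ν * T, x₀) (fun s y => fderiv ℝ (fun y => ν⁻¹ • u (s / ν) y) y) ≤ (M : ENNReal) := by
  intro ν T hν hT u p hmax hLH hdec htend x₀ r a r₀ C J c η hs hj ha1 ha2 hr₀ hC hJ hc hη htemp hfloor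
  have ht := hNA ν T hν hT u p hmax hLH hdec htend x₀ r a r₀ C J c η hs hj ha1 ha2 hr₀ hC hJ hc hη htemp hfloor
  have hev := ht.eventually_mem (Iic_mem_nhds zero_lt_one)
  obtain ⟨ε, hε, hsub⟩ := mem_nhdsGT_iff_exists_Ioo_subset.1 hev
  refine ⟨ε / 2, 1, half_pos hε, fun r' hr' => ?_⟩
  have hmem : r' ∈ Set.Ioo (0 : ℝ) ε := ⟨hr'.1, lt_of_le_of_lt hr'.2 (half_lt_self hε)⟩
  have h1 := hsub hmem
  rw [Set.mem_setOf_eq, Set.mem_Iic] at h1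
  simpa using h1

/-! ## K10 · THE BUDGET RUNG IS A THEOREM: CC ⟹ D0 -/

/-- **finite dissipation of the normalised classical solution on the slab** `(0, νT) × ℝ³`: the classical gradient of
`vN ν u` is a weak spatial gradient on the slab (smoothness) and so agrees a.e. with the square-integrable Leray–Hopf
gradient of the viscosity-rescaled Leray–Hopf solution. [folklore; tree `IsLerayHopfOn.exists_hasWeakSpatialGradientOn`,
`HasWeakSpatialGradientOn.ae_eq`, `IsLerayHopfOn.viscosityRescale`] -/
theorem slab_fderiv_vN_lt_top {ν T : ℝ} (hν : 0 < ν) (_hT : 0 < T)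
    {u : ℝ → EuclideanSpace ℝ (Fin 3) → EuclideanSpace ℝ (Fin 3)} {p : ℝ → EuclideanSpace ℝ (Fin 3) → ℝ}
    (hcl : IsClassicalNSSolutionOn (Set.Ico 0 T) ν 0 u p) (hLH : IsLerayHopfOn T ν 0 (u 0) u) :
    ∫⁻ w in Set.Ioo 0 (ν * T) ×ˢ (univ : Set (EuclideanSpace ℝ (Fin 3))),
      ENNReal.ofReal (frobeniusNormSq (fderiv ℝ ((fun s y => ν⁻¹ • u (s / ν) y) w.1) w.2)) < ∞ := by
  have hν0 : ν ≠ 0 := hν.ne'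
  have hνi : 0 < ν⁻¹ := inv_pos.2 hν
  set v : ℝ → EuclideanSpace ℝ (Fin 3) → EuclideanSpace ℝ (Fin 3) := timeRescale ν⁻¹ ν⁻¹ u with hv
  set π : ℝ → EuclideanSpace ℝ (Fin 3) → ℝ := timeRescale ν⁻¹ (ν⁻¹ ^ 2) p with hπ
  have hvN : (fun s y => ν⁻¹ • u (s / ν) y) = v := by
    funext s y; simp [hv, div_eq_inv_mul]
  have hslice : ∀ s, v s = ν⁻¹ • u (ν⁻¹ * s) := fun s => rfl
  have hmaps : MapsTo (fun s => ν⁻¹ * s) (Ico 0 (ν * T)) (Ico 0 T) := by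
    intro s hs'
    refine ⟨mul_nonneg hνi.le hs'.1, ?_⟩
    calc ν⁻¹ * s < ν⁻¹ * (ν * T) := mul_lt_mul_of_pos_left hs'.2 hνi
      _ = T := by rw [← mul_assoc, inv_mul_cancel₀ hν0, one_mul]
  have hs' : IsClassicalNSSolutionOn (Ico 0 (ν * T)) 1 0 v π := by
    have := hcl.viscosityRescale_set hν0 hmaps (uniqueDiffOn_Ico 0 (ν * T))
    rwa [timeRescale_zero_force] at this
  have hv0 : v 0 = ν⁻¹ • u 0 := by rw [hslice, mul_zero]
  have hLH' : IsLerayHopfOn (ν * T) 1 0 (v 0) v := by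
    have := hLH.viscosityRescale hνi
    rw [div_inv_eq_mul, mul_comm T ν, inv_mul_cancel₀ hν0, timeRescale_zero_force] at this
    rwa [hv0]
  rw [hvN]
  obtain ⟨G', hG'slab, -, hG'int, -⟩ := hLH'.exists_hasWeakSpatialGradientOn
  have hsm : IsSmoothSpaceTimeOn (Ioo 0 (ν * T)) v := hs'.smooth_velocity.mono Ioo_subset_Ico_self
  have hGv : HasWeakSpatialGradientOn (slab (EuclideanSpace ℝ (Fin 3)) (Ioo 0 (ν * T)) isOpen_Ioo) v
      fun t x => fderiv ℝ (v t) x :=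
    hasWeakSpatialGradientOn_of_contDiffOn isOpen_Ioo (by rw [coe_slab]) (hsm.of_le (by exact_mod_cast le_top))
  have hae := hGv.ae_eq hG'slab
  rw [coe_slab] at hae
  calc ∫⁻ w in Ioo 0 (ν * T) ×ˢ (univ : Set (EuclideanSpace ℝ (Fin 3))),
        ENNReal.ofReal (frobeniusNormSq (fderiv ℝ (v w.1) w.2))
      = ∫⁻ w in Ioo 0 (ν * T) ×ˢ (univ : Set (EuclideanSpace ℝ (Fin 3))),
          ENNReal.ofReal (frobeniusNormSq (G' w.1 w.2)) := by
        refine lintegral_congr_ae ?_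
        filter_upwards [hae] with w hw
        change ENNReal.ofReal (frobeniusNormSq (uncurry (fun t x => fderiv ℝ (v t) x) w)) =
          ENNReal.ofReal (frobeniusNormSq (uncurry G' w))
        rw [hw]
    _ < ∞ := hG'int

/-- weight algebra: for `Φ ≤ 1` in `ℝ≥0∞`, `Φ·X^{2/3} ≤ (ΦX)^{2/3}` and `Φ·(Y^{2/3}X^{1/3}) = (ΦY)^{2/3}(ΦX)^{1/3}`. -/
theorem weight_two_thirds {Φ X : ℝ≥0∞} (hΦ : Φ ≤ 1) :
    Φ * X ^ (2 / 3 : ℝ) ≤ (Φ * X) ^ (2 / 3 : ℝ) := by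
  have hsplit : Φ = Φ ^ (2 / 3 : ℝ) * Φ ^ (1 / 3 : ℝ) := by
    rw [← ENNReal.rpow_add_of_nonneg (2 / 3 : ℝ) (1 / 3) (by norm_num) (by norm_num)]; norm_num
  have h13 : Φ ^ (1 / 3 : ℝ) ≤ 1 := ENNReal.rpow_le_one hΦ (by norm_num)
  calc Φ * X ^ (2 / 3 : ℝ) = Φ ^ (2 / 3 : ℝ) * Φ ^ (1 / 3 : ℝ) * X ^ (2 / 3 : ℝ) := by rw [← hsplit]
    _ ≤ Φ ^ (2 / 3 : ℝ) * 1 * X ^ (2 / 3 : ℝ) := by gcongr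
    _ = (Φ * X) ^ (2 / 3 : ℝ) := by rw [mul_one, ENNReal.mul_rpow_of_nonneg _ _ (by norm_num)]

/-- splitting the gauge weight over the cubic pressure × velocity term: `Φ·(Y^{2/3}·X^{1/3}) = (ΦY)^{2/3}·(ΦX)^{1/3}`
(exponent bookkeeping `Φ = Φ^{2/3}·Φ^{1/3}` in `ℝ≥0∞`). -/
theorem weight_split {Φ X Y : ℝ≥0∞} :
    Φ * (Y ^ (2 / 3 : ℝ) * X ^ (1 / 3 : ℝ)) = (Φ * Y) ^ (2 / 3 : ℝ) * (Φ * X) ^ (1 / 3 : ℝ) := by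
  have hsplit : Φ = Φ ^ (2 / 3 : ℝ) * Φ ^ (1 / 3 : ℝ) := by
    rw [← ENNReal.rpow_add_of_nonneg (2 / 3 : ℝ) (1 / 3) (by norm_num) (by norm_num)]; norm_num
  rw [ENNReal.mul_rpow_of_nonneg _ _ (by norm_num : (0 : ℝ) ≤ 2 / 3),
    ENNReal.mul_rpow_of_nonneg _ _ (by norm_num : (0 : ℝ) ≤ 1 / 3)]
  conv_lhs => rw [hsplit]
  ring

/-- **K10 · `ConicalSkirtDissipationBudget` ⟸ `ConicalSkirtCubicGauge`** (the budget rung D0 is a THEOREM given CC). -/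
theorem dissipationBudget_of_cubicGauge
    (hCC : ∀ (ν T : ℝ), 0 < ν → 0 < T → ∀ (u : ℝ → EuclideanSpace ℝ (Fin 3) → EuclideanSpace ℝ (Fin 3)) (p : ℝ → EuclideanSpace ℝ (Fin 3) → ℝ), Literature.Analysis.FluidPDE.IsMaximalSmoothSolution ν 0 u p T → Literature.Analysis.FluidPDE.IsLerayHopfOn T ν 0 (u 0) u → Literature.Analysis.FluidPDE.HasRapidSpatialDecay (u 0) → Filter.Tendsto (fun t => MeasureTheory.eLpNorm (u t - u T) 2 MeasureTheory.volume) (nhdsWithin T (Set.Iio T)) (nhds 0) → ∀ (x₀ : EuclideanSpace ℝ (Fin 3)) (r : ℕ → ℝ) (a r₀ C J c η : ℝ), ((∀ k, 0 < r k) ∧ Filter.Tendsto r Filter.atTop (nhds 0) ∧ Filter.Tendsto (fun k => (r k)⁻¹ * ∫ x in Metric.ball x₀ (r k), ‖u T x‖ ^ 2) Filter.atTop Filter.atTop) → (∃ c : ℝ, 0 < c ∧ ∀ k, ∃ t ∈ Set.Ioo (T - r k ^ 2) T, c * (∫ x in Metric.ball x₀ (r k), ‖u T x‖ ^ 2) <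 ∫ x in Metric.ball x₀ (r k), ‖u t x - u T x‖ ^ 2) → 1 < a → a ≤ 3 / 2 → 0 < r₀ → 0 ≤ C → 0 ≤ J → 0 < c → 0 < η → (∀ ρ ∈ Set.Ioc 0 r₀, (∫⁻ x in Metric.ball x₀ ρ, ‖u T x‖ₑ ^ 2 ≤ ENNReal.ofReal (C * ρ ^ (3 - 2 * a))) ∧ ∀ s ∈ Set.Ioo (T - ρ ^ 2 / ν) T, ∫⁻ x in Metric.ball x₀ ρ, ‖u s x - u T x‖ₑ ^ 2 ≤ ENNReal.ofReal J * ∫⁻ x in Metric.ball x₀ ρ, ‖u T x‖ₑ ^ 2) → (∀ k : ℕ, ENNReal.ofReal (c * r k ^ (3 - 2 * a)) ≤ ∫⁻ x in Metric.ball x₀ (r k), ‖u T x‖ₑ ^ 2 ∧ ∀ s ∈ Set.Ioo (T - r k ^ (1 + a) / ν) T, ENNReal.ofReal η * ∫⁻ x in Metric.ball x₀ (r k), ‖u T x‖ₑ ^ 2 ≤ ∫⁻ x in Metric.ball x₀ (r k), ‖u s x‖ₑ ^ 2) → ∃ (r₁ : ℝ) (M : NNReal), 0 < r₁ ∧ ∀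 r' ∈ Set.Ioc 0 r₁, ENNReal.ofReal (r' ^ (2 * (a - 1))) * Literature.Analysis.FluidPDE.cknC r' (ν * T, x₀) (fun s y => ν⁻¹ • u (s / ν) y) ≤ (M : ENNReal)) :
    ∀ (ν T : ℝ), 0 < ν → 0 < T → ∀ (u : ℝ → EuclideanSpace ℝ (Fin 3) → EuclideanSpace ℝ (Fin 3)) (p : ℝ → EuclideanSpace ℝ (Fin 3) → ℝ), Literature.Analysis.FluidPDE.IsMaximalSmoothSolution ν 0 u p T → Literature.Analysis.FluidPDE.IsLerayHopfOn T ν 0 (u 0) u → Literature.Analysis.FluidPDE.HasRapidSpatialDecay (u 0) → Filter.Tendsto (fun t => MeasureTheory.eLpNorm (u t - u T) 2 MeasureTheory.volume) (nhdsWithin T (Set.Iio T)) (nhds 0) → ∀ (x₀ : EuclideanSpace ℝ (Fin 3)) (r : ℕ → ℝ) (a r₀ C J c η : ℝ), ((∀ k, 0 < r k) ∧ Filter.Tendsto r Filter.atTop (nhds 0) ∧ Filter.Tendsto (fun k => (r k)⁻¹ * ∫ x in Metric.ball x₀ (r k), ‖u T x‖ ^ 2) Filter.atTop Filter.atTop)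 → (∃ c : ℝ, 0 < c ∧ ∀ k, ∃ t ∈ Set.Ioo (T - r k ^ 2) T, c * (∫ x in Metric.ball x₀ (r k), ‖u T x‖ ^ 2) < ∫ x in Metric.ball x₀ (r k), ‖u t x - u T x‖ ^ 2) → 1 < a → a ≤ 3 / 2 → 0 < r₀ → 0 ≤ C → 0 ≤ J → 0 < c → 0 < η → (∀ ρ ∈ Set.Ioc 0 r₀, (∫⁻ x in Metric.ball x₀ ρ, ‖u T x‖ₑ ^ 2 ≤ ENNReal.ofReal (C * ρ ^ (3 - 2 * a))) ∧ ∀ s ∈ Set.Ioo (T - ρ ^ 2 / ν) T, ∫⁻ x in Metric.ball x₀ ρ, ‖u s x - u T x‖ₑ ^ 2 ≤ ENNReal.ofReal J * ∫⁻ x in Metric.ball x₀ ρ, ‖u T x‖ₑ ^ 2) → (∀ k : ℕ, ENNReal.ofReal (c * r k ^ (3 - 2 * a)) ≤ ∫⁻ x in Metric.ball x₀ (r k), ‖u T x‖ₑ ^ 2 ∧ ∀ s ∈ Set.Ioo (T - r k ^ (1 + a) / ν) T, ENNReal.ofReal η * ∫⁻ x in Metric.ball x₀ (r k), ‖u T x‖ₑ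 ^ 2 ≤ ∫⁻ x in Metric.ball x₀ (r k), ‖u s x‖ₑ ^ 2) → ∃ (r₁ : ℝ) (M : NNReal), 0 < r₁ ∧ ∀ r' ∈ Set.Ioc 0 r₁, ENNReal.ofReal (r' ^ (2 * (a - 1))) * Literature.Analysis.FluidPDE.cknE r' (ν * T, x₀) (fun s y => fderiv ℝ (fun y => ν⁻¹ • u (s / ν) y) y) ≤ (M : ENNReal) := by
  intro ν T hν hT u p hmax hLH hdec htend x₀ r a r₀ C J c η hs hj ha1 ha2 hr₀ hC hJ hc hη htemp hfloor
  obtain ⟨rC, MC, hrC, hCg⟩ :=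
    hCC ν T hν hT u p hmax hLH hdec htend x₀ r a r₀ C J c η hs hj ha1 ha2 hr₀ hC hJ hc hη htemp hfloor
  set vNu : ℝ → EuclideanSpace ℝ (Fin 3) → EuclideanSpace ℝ (Fin 3) := fun s y => ν⁻¹ • u (s / ν) y
    with hvNu_def
  set qNu : ℝ → EuclideanSpace ℝ (Fin 3) → ℝ := fun s y => (timeRescale ν⁻¹ (ν⁻¹ ^ 2) p) s y -
      ((timeRescale ν⁻¹ (ν⁻¹ ^ 2) p) s 0 - normalisedPressure (timeRescale ν⁻¹ ν⁻¹ u s) 0) with hqNu_def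
  have hνT : 0 < ν * T := mul_pos hν hT
  set r₁ : ℝ := min (min rC 1) (Real.sqrt (ν * T)) with hr₁def
  have hr₁ : 0 < r₁ := lt_min (lt_min hrC one_pos) (Real.sqrt_pos.2 hνT)
  have hr₁C : r₁ ≤ rC := (min_le_left _ _).trans (min_le_left _ _)
  have hr₁1 : r₁ ≤ 1 := (min_le_left _ _).trans (min_le_right _ _)
  have hr₁T : r₁ ^ 2 ≤ ν * T := by
    have h1 : r₁ ≤ Real.sqrt (ν * T) := min_le_right _ _
    calc r₁ ^ 2 ≤ Real.sqrt (ν * T) ^ 2 := pow_le_pow_left₀ hr₁.le h1 2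
      _ = ν * T := Real.sq_sqrt hνT.le
  -- finiteness of the classical gradient energy of the normalised solution on `Q_{r₁}(νT, x₀) ⊆ (0, νT) × ℝ³`
  have hsubQ : parabolicCylinder r₁ (ν * T, x₀) ⊆
      Set.Ioo 0 (ν * T) ×ˢ (univ : Set (EuclideanSpace ℝ (Fin 3))) := by
    intro w hw
    rw [mem_parabolicCylinder] at hw
    exact ⟨⟨by linarith [hw.1.1], hw.1.2⟩, mem_univ _⟩
  have hE₁ : ∫⁻ w in parabolicCylinder r₁ (ν * T, x₀),
      ENNReal.ofReal (frobeniusNormSq (fderiv ℝ ((fun s y => ν⁻¹ • u (s / ν) y) w.1) w.2)) < ∞ :=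
    lt_of_le_of_lt (lintegral_mono_set hsubQ) (slab_fderiv_vN_lt_top hν hT hmax.1 hLH)
  obtain ⟨hIn₁, hG₁⟩ := apex_suitable hν hT hmax.1 hLH x₀ hr₁ hr₁T hE₁
  -- the pressure gauge (K6) at the cubic exponent γ = 2(a − 1) ∈ (0, 1]
  have hγ : 0 < 2 * (a - 1) := by linarith
  have hγ1 : 2 * (a - 1) ≤ 1 := by linarith
  have hD₁ : cknD r₁ (ν * T, x₀) (qNu) ≠ ∞ := cknD_ne_top_of_memLp hr₁ hIn₁.2.2.2
  obtain ⟨MD, hMD⟩ := pressureGauge_of_cubicGauge hr₁ hγ hγ1 hIn₁.1.distributional hD₁ (MC := MC)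
    (fun r' hr' => hCg r' ⟨hr'.1, hr'.2.trans hr₁C⟩)
  -- the local energy bound at cylinders touching the top
  obtain ⟨c₁, c₂, c₃, hLEB⟩ := Seregin2020.localEnergyBound_top
  refine ⟨r₁ / 2, c₁ * MC ^ (2 / 3 : ℝ) + c₂ * MC + c₃ * (MD ^ (2 / 3 : ℝ) * MC ^ (1 / 3 : ℝ)), half_pos hr₁,
    fun s hs0 => ?_⟩
  set z : ℝ × EuclideanSpace ℝ (Fin 3) := (ν * T, x₀) with hz
  set t : ℝ := 2 * s with htdef
  have ht0 : 0 < t := by rw [htdef]; linarith [hs0.1]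
  have ht1 : t ≤ r₁ := by rw [htdef]; linarith [hs0.2]
  have hts : t / 2 = s := by rw [htdef]; ring
  have hQt : parabolicCylinder t z ⊆ (parabolicCylinderOpens r₁ z : Set (ℝ × EuclideanSpace ℝ (Fin 3))) := by
    rw [coe_parabolicCylinderOpens]; exact parabolicCylinder_mono ht0.le ht1 z
  have hleb := hLEB (parabolicCylinderOpens r₁ z) (vNu) (qNu) (fun s y => fderiv ℝ (vNu s) y)
    hIn₁.1 hG₁ z t ht0 hQt
  rw [hts] at hleb
  -- the weights
  set Φ : ℝ≥0∞ := ENNReal.ofReal (t ^ (2 * (a - 1))) with hΦdef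
  have hΦ1 : Φ ≤ 1 := ENNReal.ofReal_le_one.2 (Real.rpow_le_one ht0.le (ht1.trans hr₁1) hγ.le)
  have hΦs : ENNReal.ofReal (s ^ (2 * (a - 1))) ≤ Φ :=
    ENNReal.ofReal_le_ofReal (Real.rpow_le_rpow hs0.1.le (by rw [htdef]; linarith [hs0.1]) hγ.le)
  have htI : t ∈ Set.Ioc 0 r₁ := ⟨ht0, ht1⟩
  have hX : Φ * cknC t z (vNu) ≤ MC := hCg t ⟨ht0, ht1.trans hr₁C⟩
  have hY : Φ * cknD t z (qNu) ≤ MD := hMD t htI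
  -- assemble
  show ENNReal.ofReal (s ^ (2 * (a - 1))) * cknE s z (fun s y => fderiv ℝ (vNu s) y) ≤ _
  have hcoe : ((c₁ * MC ^ (2 / 3 : ℝ) + c₂ * MC + c₃ * (MD ^ (2 / 3 : ℝ) * MC ^ (1 / 3 : ℝ)) : ℝ≥0) : ℝ≥0∞)
      = c₁ * (MC : ℝ≥0∞) ^ (2 / 3 : ℝ) + c₂ * MC + c₃ * ((MD : ℝ≥0∞) ^ (2 / 3 : ℝ) * (MC : ℝ≥0∞) ^ (1 / 3 : ℝ)) := by
    rw [ENNReal.coe_add, ENNReal.coe_add, ENNReal.coe_mul, ENNReal.coe_mul, ENNReal.coe_mul, ENNReal.coe_mul,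
      ENNReal.coe_rpow_of_nonneg _ (by norm_num : (0 : ℝ) ≤ 2 / 3),
      ENNReal.coe_rpow_of_nonneg _ (by norm_num : (0 : ℝ) ≤ 2 / 3),
      ENNReal.coe_rpow_of_nonneg _ (by norm_num : (0 : ℝ) ≤ 1 / 3)]
  rw [hcoe]
  calc ENNReal.ofReal (s ^ (2 * (a - 1))) * cknE s z (fun s y => fderiv ℝ (vNu s) y)
      ≤ Φ * (cknAEss s z (vNu) + cknE s z (fun s y => fderiv ℝ (vNu s) y)) :=
        mul_le_mul' hΦs le_add_self
    _ ≤ Φ * (c₁ * cknC t z (vNu) ^ (2 / 3 : ℝ) + c₂ * cknC t z (vNu) +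
          c₃ * (cknD t z (qNu) ^ (2 / 3 : ℝ) * cknC t z (vNu) ^ (1 / 3 : ℝ))) :=
        mul_le_mul' le_rfl hleb
    _ = c₁ * (Φ * cknC t z (vNu) ^ (2 / 3 : ℝ)) + c₂ * (Φ * cknC t z (vNu)) +
          c₃ * (Φ * (cknD t z (qNu) ^ (2 / 3 : ℝ) * cknC t z (vNu) ^ (1 / 3 : ℝ))) := by ring
    _ ≤ c₁ * (Φ * cknC t z (vNu)) ^ (2 / 3 : ℝ) + c₂ * (Φ * cknC t z (vNu)) +
          c₃ * ((Φ * cknD t z (qNu)) ^ (2 / 3 : ℝ) * (Φ * cknC t z (vNu)) ^ (1 / 3 : ℝ)) := by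
        rw [weight_split]
        gcongr
        exact weight_two_thirds hΦ1
    _ ≤ c₁ * (MC : ℝ≥0∞) ^ (2 / 3 : ℝ) + c₂ * MC +
          c₃ * ((MD : ℝ≥0∞) ^ (2 / 3 : ℝ) * (MC : ℝ≥0∞) ^ (1 / 3 : ℝ)) := by
        gcongr

end Summit.NavierStokesRegularity.NavierStokesRegularity.Theorems.RootDecompStaticSkirtOnsagerLadder

end
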